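import Literature.NumberTheory.Transcendental.DiazParams
import HarnessLib

/-!
# Diaz 1989, Théorème 2 — the parameters `L, M, M₁, ρ` as functions of `X` (no `D`)

Topic `Literature/NumberTheory/Transcendental` (trunk T-TRANSCEND). First step of the reduction of
the named fact `Literature.NumberTheory.Transcendental.Diaz1989_thm2` (`DiazMain.lean`; G. Diaz,
J. Number Theory 31 (1989), Théorème 2, p. 2: `trdeg_ℚ ℚ(e^{u_hv_k}) ≥ [mn/(m+n)]` under (HT2)
and `mn > m + n`) to Philippon's criterion and the zero lemma, along the lines of the tree's
reduction of Théorème 1 (`DiazParams.lean`, `DiazSmallness.lean`, `DiazZeroFreeBall.lean`,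
`DiazThm1Proofs.lean`, all in the namespace `DiazThm1`).

Théorème 2 concerns the field generated by the `e^{u_hv_k}` alone (Schneider's method on `𝔾ₘⁿ`
rather than on `𝔾ₐ × 𝔾ₘⁿ`): the auxiliary function is `F(z) = ∑_{|λ|<L} p_λ e^{(λ.u)z}` with
`p_λ = P_λ(e^{u_hv_k})`, i.e. the construction of `DiazConstruction.lean` with `D = 1` (no power
of `z`, so that the `P_{dλ}`, `Q_μ`, `Q_{μj}` do not involve the variables `Y_k`). The parameters
(our choice, playing for Théorème 2 the role of §II-4-1, p. 15, for Théorème 1) are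
`L = [a₁Xᵐ]`, `M = [Xⁿ]`, `M₁ = a₂M`, `ρ = 16(n+1)X^{mn} log X`, with the constants `a₁`, `a₂` of
`DiazParams.lean`; the orders of magnitude are `Lⁿ ≍ Mᵐ ≍ X^{mn}` (Siegel), degrees `≍ LM₁ ≍ X^{m+n}`,
smallness `≍ X^{mn} log X` (the factor `log X` is earned by extrapolating to the radius
`R = 8rX^{mn-m-n}`, which is where `mn > m + n` enters). This file proves the elementary
consequences used downstream, each as an eventual statement in `X`:

* `L_le`, `M_le`, `eventually_L_ge`, `eventually_M_ge` — sandwiches;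
* `eventually_C1` — (𝒞1) `2^{mn+m+1} Mᵐ ≤ 1 · Lⁿ` (Siegel's step with `D = 1`);
* `eventually_C7`, `eventually_C8` — the hypotheses (11) of the zero lemma with `S = M₁ - 1`,
  `D₀ = 1`, `D₁ = L - 1` (the second one needs `mn > m + n`).

Everything here is proved (no new named facts).

## References

* G. Diaz, *Grands degrés de transcendance pour des familles d'exponentielles*, J. Number Theory
  31 (1989), 1–23, Théorème 2, p. 2; §II-2 (𝒞1) p. 5, §II-3-4 (𝒞7), (𝒞8) p. 13, §II-4-1 p. 15
  (the scheme followed, printed there for Théorème 1).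
* M. Waldschmidt, Ch. 14 of Yu. V. Nesterenko, P. Philippon (eds.), *Introduction to Algebraic
  Independence Theory*, LNM 1752 (2001), §2.2 (Thm 2.7) and §3 (Schneider's method on `𝔾ₘ^d`).
-/

noncomputable section

open Filter Real Literature.NumberTheory.Transcendental.Asymp

namespace Literature.NumberTheory.Transcendental

namespace DiazThm2

open DiazThm1 (a1 a2 one_le_a1 one_le_a2 pow_le_a1_pow a2_eq)

/-- `L = [a₁ Xᵐ]`. [cite: Diaz1989, Théorème 2 p. 2 (our parameters, cf. §II-4-1 p. 15)] -/
def Lq (m n : ℕ) (X : ℝ) : ℕ := ⌊a1 m n * scale m 0 X⌋₊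

/-- `M = [Xⁿ]`. [cite: Diaz1989, Théorème 2 p. 2 (our parameters, cf. §II-4-1 p. 15)] -/
def Mq (n : ℕ) (X : ℝ) : ℕ := ⌊scale n 0 X⌋₊

/-- `M₁ = a₂ M`. [cite: Diaz1989, Théorème 2 p. 2 (our parameters, cf. §II-4-1 p. 15)] -/
def M1q (m n : ℕ) (X : ℝ) : ℕ := a2 m n * Mq n X

/-- `ρ = 16(n+1) X^{mn} log X`. [cite: Diaz1989, Théorème 2 p. 2 (our parameters, cf. §II-4-1 p. 15)] -/
def rhoq (m n : ℕ) (X : ℝ) : ℝ := 16 * (n + 1) * scale (m * n) 1 X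

variable {m n : ℕ}

/-! ### Sandwiches -/

/-- `L ≤ a₁ Xᵐ` (`X ≥ 1`). [folklore] -/
theorem L_le {X : ℝ} (hX : 1 ≤ X) : (Lq m n X : ℝ) ≤ a1 m n * scale m 0 X :=
  Nat.floor_le (mul_nonneg (Nat.cast_nonneg _) (scale_nonneg hX))

/-- `M ≤ Xⁿ` (`X ≥ 1`). [folklore] -/
theorem M_le {X : ℝ} (hX : 1 ≤ X) : (Mq n X : ℝ) ≤ scale n 0 X :=
  Nat.floor_le (scale_nonneg hX)

/-- Eventually `L ≥ a₁Xᵐ/2` and `L ≥ 2` (`m ≥ 1`). [folklore] -/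
theorem eventually_L_ge (hm : 1 ≤ m) :
    ∀ᶠ X in atTop, a1 m n * scale m 0 X / 2 ≤ (Lq m n X : ℝ) ∧ 2 ≤ Lq m n X := by
  have h4 : ∀ᶠ X in atTop, (4 : ℝ) ≤ a1 m n * scale m 0 X := by
    have ha : (1 : ℝ) ≤ a1 m n := by exact_mod_cast one_le_a1 (m := m) (n := n)
    have h4' : ∀ᶠ X in atTop, (4 : ℝ) ≤ scale m 0 X :=
      eventually_const_le_scale (Or.inl (by exact_mod_cast hm)) 4
    filter_upwards [h4', eventually_ge_atTop (1 : ℝ)] with X hX hX1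
    calc (4 : ℝ) ≤ scale m 0 X := hX
      _ ≤ a1 m n * scale m 0 X := le_mul_of_one_le_left (scale_nonneg hX1) ha
  filter_upwards [h4] with X hX
  have hfl := Nat.lt_floor_add_one (a1 m n * scale m 0 X)
  have h1 : a1 m n * scale m 0 X / 2 ≤ (Lq m n X : ℝ) := by unfold Lq; linarith
  refine ⟨h1, ?_⟩
  have : (2 : ℝ) ≤ (Lq m n X : ℝ) := by linarith
  exact_mod_cast this

/-- Eventually `M ≥ Xⁿ/2` and `M ≥ 2` (`n ≥ 1`). [folklore] -/
theorem eventually_M_ge (hn : 1 ≤ n) :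
    ∀ᶠ X in atTop, scale n 0 X / 2 ≤ (Mq n X : ℝ) ∧ 2 ≤ Mq n X := by
  have h4 : ∀ᶠ X in atTop, (4 : ℝ) ≤ scale n 0 X :=
    eventually_const_le_scale (Or.inl (by exact_mod_cast hn)) 4
  filter_upwards [h4] with X hX
  have hfl := Nat.lt_floor_add_one (scale n 0 X)
  have h1 : scale n 0 X / 2 ≤ (Mq n X : ℝ) := by unfold Mq; linarith
  refine ⟨h1, ?_⟩
  have : (2 : ℝ) ≤ (Mq n X : ℝ) := by linarith
  exact_mod_cast this

/-- `1 ≤ M₁` as soon as `1 ≤ M`. [folklore] -/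
theorem one_le_M1 {X : ℝ} (hM : 1 ≤ Mq n X) : 1 ≤ M1q m n X := by
  unfold M1q; exact le_trans one_le_a2 (Nat.le_mul_of_pos_right _ (by omega))

/-- `M ≤ M₁`. [folklore] -/
theorem M_le_M1 (X : ℝ) : Mq n X ≤ M1q m n X :=
  Nat.le_mul_of_pos_left _ (by have := one_le_a2 (m := m) (n := n); omega)

/-- `(M₁ : ℝ) = a₂ M`. [folklore] -/
theorem M1_eq (X : ℝ) : (M1q m n X : ℝ) = a2 m n * Mq n X := by
  unfold M1q; push_cast; ring

/-! ### (𝒞1) with `D = 1` -/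

/-- **(𝒞1) eventually**: `2^{mn+m+1} Mᵐ ≤ 1 · Lⁿ` (for `m, n ≥ 1`).
[cite: Diaz1989, §II-2 (𝒞1) p. 5] -/
theorem eventually_C1 (hm : 1 ≤ m) (hn : 1 ≤ n) :
    ∀ᶠ X in atTop, 2 ^ (m + n * m + 1) * Mq n X ^ m ≤ 1 * Lq m n X ^ n := by
  filter_upwards [eventually_L_ge (m := m) (n := n) hm, eventually_gt_atTop (1 : ℝ)] with X hL hX1
  have ha1 : (1 : ℝ) ≤ a1 m n := by exact_mod_cast one_le_a1 (m := m) (n := n)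
  have hsL : 0 ≤ scale m 0 X := scale_nonneg hX1.le
  set Z : ℝ := scale (m * n) 0 X with hZ
  have hZ0 : 0 ≤ Z := scale_nonneg hX1.le
  have e1 : scale n 0 X ^ m = Z := by
    rw [hZ, scale_pow hX1.le]; congr 1
    · ring
    · simp
  have e2 : scale m 0 X ^ n = Z := by
    rw [hZ, scale_pow hX1.le]; congr 1
    · simp
  have key : (2 : ℝ) ^ (m + n * m + 1) * (Mq n X : ℝ) ^ m ≤ 1 * (Lq m n X : ℝ) ^ n := by
    have hMm : (Mq n X : ℝ) ^ m ≤ Z := by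
      rw [← e1]; exact pow_le_pow_left₀ (Nat.cast_nonneg _) (M_le (n := n) hX1.le) m
    calc (2 : ℝ) ^ (m + n * m + 1) * (Mq n X : ℝ) ^ m ≤ 2 ^ (m + n * m + 1) * Z :=
          mul_le_mul_of_nonneg_left hMm (by positivity)
      _ ≤ ((a1 m n : ℝ) ^ n / 2 ^ (n + 1)) * Z := by
          refine mul_le_mul_of_nonneg_right ?_ hZ0
          rw [le_div_iff₀ (by positivity)]
          exact pow_le_a1_pow hn
      _ ≤ ((a1 m n : ℝ) ^ n / 2 ^ n) * Z := by
          refine mul_le_mul_of_nonneg_right ?_ hZ0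
          have h2n : (0 : ℝ) < 2 ^ n := by positivity
          have han : (0 : ℝ) ≤ (a1 m n : ℝ) ^ n := by positivity
          have hle : (2 : ℝ) ^ n ≤ 2 ^ (n + 1) := pow_le_pow_right₀ (by norm_num) (by omega)
          exact div_le_div_of_nonneg_left han h2n hle
      _ = 1 * (a1 m n * scale m 0 X / 2) ^ n := by
          rw [← e2, div_pow, mul_pow]
          ring
      _ ≤ 1 * (Lq m n X : ℝ) ^ n :=
          mul_le_mul_of_nonneg_left (pow_le_pow_left₀ (by positivity) hL.1 n) zero_le_one
  exact_mod_cast key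

/-! ### (𝒞7), (𝒞8): the hypotheses (11) of the zero lemma (`D₀ = 1`, `D₁ = L - 1`, `S = M₁ - 1`) -/

/-- Eventually `(M₁ - 1)/(n+1) ≥ b · Xⁿ` with `b = (n+1)! a₁ⁿ + 1 = a₂/(4(n+1))` (`n ≥ 1`).
[folklore] -/
theorem eventually_M1_sub_one_div_ge (hn : 1 ≤ n) :
    ∀ᶠ X in atTop, ((n + 1).factorial * (a1 m n : ℝ) ^ n + 1) * scale n 0 X ≤
      ((M1q m n X - 1 : ℕ) : ℝ) / (n + 1) := by
  filter_upwards [eventually_M_ge (n := n) hn, eventually_gt_atTop (1 : ℝ)] with X hM hX1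
  set b : ℝ := (n + 1).factorial * (a1 m n : ℝ) ^ n + 1 with hb
  have hfa : (0 : ℝ) ≤ (n + 1).factorial * (a1 m n : ℝ) ^ n := by positivity
  have hb0 : 0 ≤ b := by rw [hb]; linarith
  have hM2 : (2 : ℝ) ≤ Mq n X := by exact_mod_cast hM.2
  have hM1 : ((M1q m n X - 1 : ℕ) : ℝ) = a2 m n * Mq n X - 1 := by
    have h1 : 1 ≤ M1q m n X := one_le_M1 (by omega)
    rw [Nat.cast_sub h1]; unfold M1q; push_cast; ring
  rw [hM1, a2_eq, le_div_iff₀ (by positivity), ← hb]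
  have hs : scale n 0 X / 2 ≤ (Mq n X : ℝ) := hM.1
  have hs0 : 0 ≤ scale n 0 X := scale_nonneg hX1.le
  have h1 : b * scale n 0 X * (n + 1) ≤ 2 * (n + 1) * b * Mq n X := by
    have := mul_le_mul_of_nonneg_left hs (show (0 : ℝ) ≤ 2 * (n + 1) * b by positivity)
    nlinarith
  have h2 : (1 : ℝ) ≤ 2 * (n + 1) * b * Mq n X := by
    have hb1 : 1 ≤ b := by rw [hb]; linarith
    have : (1 : ℝ) ≤ (n + 1) := by
      have : (0 : ℝ) ≤ n := Nat.cast_nonneg n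
      linarith
    calc (1 : ℝ) = 1 * 1 * 1 * 1 := by ring
      _ ≤ 2 * (n + 1) * b * Mq n X := by
          refine mul_le_mul (mul_le_mul (mul_le_mul (by norm_num) this zero_le_one (by norm_num)) hb1
            zero_le_one (by positivity)) (by linarith) zero_le_one (by positivity)
  linarith

/-- **(𝒞7) eventually**: `(n+1)! · 1 · (L-1)ⁿ < ((M₁-1)/(n+1))^m` (for `m, n ≥ 1`).
[cite: Diaz1989, §II-3-4 (𝒞7) p. 13] -/
theorem eventually_C7 (hm : 1 ≤ m) (hn : 1 ≤ n) :
    ∀ᶠ X in atTop, ((n + 1).factorial : ℝ) * 1 * ((Lq m n X - 1 : ℕ) : ℝ) ^ n <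
      (((M1q m n X - 1 : ℕ) : ℝ) / (n + 1)) ^ m := by
  filter_upwards [eventually_M1_sub_one_div_ge (m := m) (n := n) hn, eventually_gt_atTop (1 : ℝ)]
    with X hM1 hX1
  set b : ℝ := (n + 1).factorial * (a1 m n : ℝ) ^ n + 1 with hb
  set Z : ℝ := scale (m * n) 0 X with hZ
  have hZpos : 0 < Z := scale_pos hX1
  have hfa : (0 : ℝ) ≤ (n + 1).factorial * (a1 m n : ℝ) ^ n := by positivity
  have hb1 : 1 ≤ b := by rw [hb]; linarith
  have e1 : scale n 0 X ^ m = Z := by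
    rw [hZ, scale_pow hX1.le]; congr 1
    · ring
    · simp
  have e2 : scale m 0 X ^ n = Z := by
    rw [hZ, scale_pow hX1.le]; congr 1
    · simp
  have hL' : ((Lq m n X - 1 : ℕ) : ℝ) ≤ a1 m n * scale m 0 X := by
    calc ((Lq m n X - 1 : ℕ) : ℝ) ≤ Lq m n X := by exact_mod_cast Nat.sub_le _ _
      _ ≤ _ := L_le hX1.le
  have hLHS : ((n + 1).factorial : ℝ) * 1 * ((Lq m n X - 1 : ℕ) : ℝ) ^ n ≤
      (n + 1).factorial * (a1 m n : ℝ) ^ n * Z := by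
    calc ((n + 1).factorial : ℝ) * 1 * ((Lq m n X - 1 : ℕ) : ℝ) ^ n
        ≤ (n + 1).factorial * 1 * (a1 m n * scale m 0 X) ^ n := by
          refine mul_le_mul_of_nonneg_left (pow_le_pow_left₀ (Nat.cast_nonneg _) hL' n)
            (by positivity)
      _ = (n + 1).factorial * (a1 m n : ℝ) ^ n * Z := by rw [← e2, mul_pow]; ring
  have hRHS : b * Z ≤ (((M1q m n X - 1 : ℕ) : ℝ) / (n + 1)) ^ m := by
    calc b * Z ≤ b ^ m * Z := mul_le_mul_of_nonneg_right
          (by calc b = b ^ 1 := (pow_one b).symm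
                _ ≤ b ^ m := pow_le_pow_right₀ hb1 hm) hZpos.le
      _ = (b * scale n 0 X) ^ m := by rw [mul_pow, e1]
      _ ≤ (((M1q m n X - 1 : ℕ) : ℝ) / (n + 1)) ^ m :=
          pow_le_pow_left₀ (mul_nonneg (by linarith) (scale_nonneg hX1.le)) hM1 m
  calc ((n + 1).factorial : ℝ) * 1 * ((Lq m n X - 1 : ℕ) : ℝ) ^ n
      ≤ (n + 1).factorial * (a1 m n : ℝ) ^ n * Z := hLHS
    _ < b * Z := by
        refine mul_lt_mul_of_pos_right ?_ hZpos
        rw [hb]; linarith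
    _ ≤ _ := hRHS

/-- **(𝒞8) eventually**: `(n+1)(L-1) < ((M₁-1)/(n+1))^{m-1}`, for `mn > m + n` (so that
`m < n(m-1)`). [cite: Diaz1989, §II-3-4 (𝒞8) p. 13] -/
theorem eventually_C8 (hn : 1 ≤ n) (hmn : m + n < m * n) :
    ∀ᶠ X in atTop, (n + 1 : ℝ) * ((Lq m n X - 1 : ℕ) : ℝ) <
      (((M1q m n X - 1 : ℕ) : ℝ) / (n + 1)) ^ (m - 1) := by
  have hm : 2 ≤ m := by
    rcases Nat.lt_or_ge m 2 with h | h
    · have : m * n ≤ 1 * n := Nat.mul_le_mul_right n (by omega)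
      omega
    · exact h
  have hlt : (m : ℝ) < ((n * (m - 1) : ℕ) : ℝ) := by
    have h1 : m < n * (m - 1) := by
      have : n * (m - 1) = n * m - n := Nat.mul_sub_one n m
      rw [this]
      have : m * n = n * m := Nat.mul_comm m n
      omega
    exact_mod_cast h1
  filter_upwards [eventually_M1_sub_one_div_ge (m := m) (n := n) hn, eventually_gt_atTop (1 : ℝ),
    eventually_mul_scale_le_of_lt hlt 0 0 (2 * (n + 1) * a1 m n)] with X hM1 hX1 hdom
  set b : ℝ := (n + 1).factorial * (a1 m n : ℝ) ^ n + 1 with hb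
  have hfa : (0 : ℝ) ≤ (n + 1).factorial * (a1 m n : ℝ) ^ n := by positivity
  have hb1 : 1 ≤ b := by rw [hb]; linarith
  have hL' : ((Lq m n X - 1 : ℕ) : ℝ) ≤ a1 m n * scale m 0 X := by
    calc ((Lq m n X - 1 : ℕ) : ℝ) ≤ Lq m n X := by exact_mod_cast Nat.sub_le _ _
      _ ≤ _ := L_le hX1.le
  have hs0 : 0 < scale ((n * (m - 1) : ℕ) : ℝ) 0 X := scale_pos hX1
  have hRHS : scale ((n * (m - 1) : ℕ) : ℝ) 0 X ≤ (((M1q m n X - 1 : ℕ) : ℝ) / (n + 1)) ^ (m - 1) := by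
    calc scale ((n * (m - 1) : ℕ) : ℝ) 0 X = scale n 0 X ^ (m - 1) := by
          rw [scale_pow hX1.le]; congr 1
          · push_cast; ring
          · simp
      _ ≤ (b * scale n 0 X) ^ (m - 1) :=
          pow_le_pow_left₀ (scale_nonneg hX1.le)
            (le_mul_of_one_le_left (scale_nonneg hX1.le) hb1) _
      _ ≤ _ := pow_le_pow_left₀ (mul_nonneg (by linarith) (scale_nonneg hX1.le)) hM1 _
  calc (n + 1 : ℝ) * ((Lq m n X - 1 : ℕ) : ℝ) ≤ (n + 1) * (a1 m n * scale m 0 X) :=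
        mul_le_mul_of_nonneg_left hL' (by positivity)
    _ = (2 * (n + 1) * a1 m n) * scale m 0 X / 2 := by ring
    _ ≤ scale ((n * (m - 1) : ℕ) : ℝ) 0 X / 2 := by linarith
    _ < scale ((n * (m - 1) : ℕ) : ℝ) 0 X := by linarith
    _ ≤ _ := hRHS

end DiazThm2

end Literature.NumberTheory.Transcendental

end
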